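import Summits.Ventures.YMGap.YM3IR.ReindexPort
import Summits.Ventures.YMGap.YM3IR.ReceiverWitness
import Summits.Ventures.YMGap.YM3IR.SteinerSize
import HarnessLib

/-!
# YM3IR / D3Port — the (St) COROLLARY of the A3 port lemma: the sender's re-indexing half composed with the receiver's doors

HONEST FRAMING (cell pub-ymgap, track Y4 / YM3-IR, seat ym3ir-theory-1; lead ruling R334 (A3 GO, G11) D1: «the D3 port
lemma ((iv-Σ) + (St) corollary) … theory-1's pen», D3 = option (St) — Steiner currency over the CORNER set at block
scale `c`, rate per lattice unit — ADOPTED).  This file is the tree edition of §J of the joint check record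
`HOME/ym3ir/lean/D3PortJoint-monolith-theory2.check.lean` (sha16 9b1d917dd32e05aa; countersigned in
`HOME/ym3ir/D3PortJoint-COUNTERSIGN-theory1.md` b710666f3504753c): the three corollaries verbatim, with the two HOME
scratches replaced by the tree modules they became — the SENDER's half `YM3IR/Reindex.lean` + `YM3IR/ReindexPort.lean`
(theory-1: `cubeSites`, `reindex`, (i) `total_reindex`, (ii-d), (iii), the meeting shape, `size_nonneg` /
`hdiam_of_supported`, (iv-Σ)), the RECEIVER's half `YM3IR/ReceiverWitness.lean` (theory-2, port file M4: (R1), (R2),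
the doors (β) `inBall_of_affineDiamData` / (δ) `inBall_of_natAffineDiamData`, §4 `mem_clusterDomain_of_analytic_affineDiam`)
and the currency `YM3IR/SteinerSize.lean` (theory-2: `steinerCard`, `polymerDiam_add_one_le_steinerCard`) — plus ONE new
composition (§2): the YES branch END TO END FROM (E1) DATA ON THE SENDER'S OWN SCALE-`c` OBJECT.  It contains NO
conjecture name, NO `sorry`, NO axiom, and claims NO mass gap, NO continuum limit, NO part of Bałaban's theorems and NO
membership of any UV output in any ball: every statement is an implication whose hypotheses ((E1) = analyticity of the
activities on domains containing the radius-`r` ball around EVERY real configuration, and the smallness `η`, `η₁` of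
the per-corner Steiner-weighted norms inside track Y2's certified radii) are exactly what a printed RG output does NOT
supply as stated (INTERFACE-MEMO M1; theory-1 md §17, §18.9–§18.11: the crossover numbers).  Nothing is imported from,
or restated of, either half beyond use BY NAME.

* §1 (= monolith §J, names unchanged, namespace `Summit.Ventures.YMGap.YM3IR.D3PortJoint`):
  `inBall_reindex_of_sizeData` ((β) ∘ (`size_nonneg`, `hdiam_of_supported`): data `M` supported on the cube sets, any
  size `st ≥ polymerDiam + 1` on polymers); `inBall_reindex_of_senderData` ((δ) ∘ (meeting shape, (iv-Σ), `c^d`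
  rider): `M = (reindex W).supNorm`, SENDER hypotheses only, any size `s`); `mem_clusterDomain_reindex_of_steinerData`
  ((St) end to end given an (E1) LOAD WITNESS of `reindex W`: `s := steinerCard`, conclusion
  `reindex W ∈ ClusterDomain κ_b (2 e^{κ_b (c−1)} η) ((2d/r) e^{κ_b (c−1)} c^d η₁)`).
* §2 (new, namespace `Summit.Ventures.YMGap.YM3IR.Reindex` for the two re-indexing lemmas): `isAnalyticOn_reindex`
  ((E1)-type analyticity data `(D, M)` of `W` at scale `c` IS analyticity data of `reindex W` — domains `D (corners S)`,
  bounds `M (corners S)` on the cube sets and `0` elsewhere); `sum_polymersThrough_supported_mul` ((iv-Σ) for any data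
  supported on the cube sets); and ★ `D3PortJoint.mem_clusterDomain_reindex_of_analytic_steinerData`: `1 ≤ c`, `ρ`
  `1`-Lipschitz into `(M_N(ℂ), ‖·‖_F)`, `W.IsAnalyticOn ρ D M` with `ball (complexify ρ U) r ⊆ D X` for every polymer `X`
  and every REAL configuration `U` ((E1) at scale `c`), `0 ≤ M`, `0 ≤ κ_b ≤ κ_s`, and the SENDER's per-CORNER analytic
  Steiner-weighted norms `∑_{X ∋ corner y} M_X e^{κ_s (st X − 1)} ≤ η`, `∑_{X ∋ corner y} M_X |X| e^{κ_s (st X − 1)} ≤ η₁`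
  ⇒ `reindex W ∈ ClusterDomain κ_b (2 e^{κ_b (c−1)} η) ((2d/r) e^{κ_b (c−1)} c^d η₁)` — track Y2's tier-2 ball BY NAME, for
  the perturbation with the SAME torus law (`total_reindex`).  No load witness, no (E2), no range control, no
  connectivity hypothesis is left; the riders `e^{κ_b (c−1)}` and `c^d` are theorems, not remarks.

NOT HERE / NOT CLAIMED: that any terminal-scale output of Bałaban's iteration satisfies (E1) with some `r > 0` uniformly,
or that its norms are `≤ η, η₁` small enough for track Y2's `su3_/suN_clusterDomainClustering…` rows — words in print and
the crossover question; the cell's label of record stands («Bałaban statements AS PRINTED with locators; ceilings are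
bookkeeping, no mass-gap / continuum / Clay claim», R196).
-/

noncomputable section

open Finset MeasureTheory Metric
open scoped Matrix.Norms.Frobenius
open Literature.MathematicalPhysics.QuantumFieldTheory hiding ZdEdge
open Summit.Ventures.YMGap.RobustBall (polymerDiam Perturbation SUN LoadWitness InBall ClusterDomain)
open Summit.Ventures.YMGap.YM3IR.ReceiverWitness (inBall_of_affineDiamData inBall_of_natAffineDiamData
  mem_clusterDomain_of_analytic_affineDiam)
open Summit.Ventures.YMGap.YM3IR.SteinerSize (steinerCard polymerDiam_add_one_le_steinerCard)

/-! ## §2a Two re-indexing lemmas for analytic / supported data -/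

namespace Summit.Ventures.YMGap.YM3IR.Reindex

variable {d L N : ℕ} [NeZero L] {G : Type*} {c : ℕ}

/-- (iv-Σ) for ANY data `M` supported on the cube sets of scale-`c` polymers: the per-SITE sum at scale `1` of
`M S · φ (corners S) S` is the per-CORNER sum over `X ∋ corner y` of `M (cubeSites c X) · φ X (cubeSites c X)`. [folklore] -/
theorem sum_polymersThrough_supported_mul {M : Finset (Site d L) → ℝ}
    (hM : ∀ S, M S ≠ 0 → ∃ X ∈ polymers (d := d) (L := L) c, S = cubeSites c X)
    (φ : Finset (Site d L) → Finset (Site d L) → ℝ) (y : Site d L) :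
    ∑ S ∈ polymersThrough 1 y, M S * φ (S.image (blockCorner c)) S
      = ∑ X ∈ polymersThrough c (blockCorner c y), M (cubeSites c X) * φ X (cubeSites c X) := by
  have hf : ∀ S, cubeSites c (S.image (blockCorner c)) ≠ S → M S * φ (S.image (blockCorner c)) S = 0 := by
    intro S hS
    have hMS : M S = 0 := by
      by_contra h
      obtain ⟨X, hX, rfl⟩ := hM S h
      exact hS (by rw [image_blockCorner_cubeSites hX])
    rw [hMS, zero_mul]
  rw [sum_polymersThrough_one_eq (c := c) (fun S => M S * φ (S.image (blockCorner c)) S) hf y]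
  refine sum_congr rfl fun X hX => ?_
  rw [image_blockCorner_cubeSites (mem_polymersThrough_iff.1 hX).1]

variable [Group G] [MeasurableSpace G]

/-- **Analyticity data re-indexes**: if the scale-`c` activities `W_X` extend holomorphically to `D X` with bounds `M X`
(Bałaban's (ii), `IsAnalyticOn`), then the re-indexed activities do so polymer by polymer at scale `1` — domain
`D (corners S)`, bound `M (corners S)` on a cube set `S`, and the zero extension with bound `0` on every other site set. [folklore] -/
theorem isAnalyticOn_reindex (W : QuasiLocalGaugePerturbation d L G c) (ρ : G →* Matrix (Fin N) (Fin N) ℂ)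
    {D : Finset (Site d L) → Set (ComplexGaugeConfig d L N)} {M : Finset (Site d L) → ℝ}
    (hA : W.IsAnalyticOn ρ D M) :
    (reindex W).IsAnalyticOn ρ (fun S => D (S.image (blockCorner c)))
      (fun S => if cubeSites c (S.image (blockCorner c)) = S then M (S.image (blockCorner c)) else 0) := by
  intro S _
  by_cases hS : cubeSites c (S.image (blockCorner c)) = S
  · obtain ⟨F, hF, hFW, hFM⟩ := hA _ (image_blockCorner_mem_polymers c S)
    refine ⟨F, hF, fun U hU => ?_, fun Z hZ => ?_⟩
    · rw [hFW U hU]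
      simp [reindex, hS]
    · simp only [if_pos hS]
      exact hFM Z hZ
  · refine ⟨0, differentiableOn_const 0, fun U _ => ?_, fun Z _ => ?_⟩
    · simp [reindex_act_of_ne W hS]
    · simp [if_neg hS]

end Summit.Ventures.YMGap.YM3IR.Reindex

/-! ## §1 The three corollaries of the joint check record (monolith §J), real names on both sides -/

namespace Summit.Ventures.YMGap.YM3IR.D3PortJoint

open Summit.Ventures.YMGap.YM3IR.Reindex

variable {d L N : ℕ} [NeZero L] {c : ℕ}

/-- (β)-COROLLARY: data `M` supported on the cube sets, any size `st ≥ polymerDiam + 1` on polymers, real-valued weight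
`e^{κ_s (st (corners S) − 1)}`, an (E1) load witness of `reindex W` ⇒ `InBall κ_b (2 e^{κ_b (c−1)} η) ((2d/r) e^{κ_b (c−1)} η₁)
(reindex W)` — theory-2's door `ReceiverWitness.inBall_of_affineDiamData` ∘ theory-1's `size_nonneg`, `hdiam_of_supported`. [folklore] -/
theorem inBall_reindex_of_sizeData (hc : 1 ≤ c)
    (W : QuasiLocalGaugePerturbation d L (SUN N) c) (w : LoadWitness (reindex W))
    {M : Finset (Site d L) → ℝ} {r : ℝ} (hr : 0 < r)
    (hosc : ∀ X e, w.osc X e ≤ 2 * M X)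
    (hlip : ∀ X, ∀ y ∈ polymerEdges (d := d) (L := L) 1 X, w.lip X y = 2 * M X / r)
    (hM : ∀ S, M S ≠ 0 → ∃ X ∈ polymers (d := d) (L := L) c, S = cubeSites c X)
    {st : Finset (Site d L) → ℕ} (hst : ∀ X ∈ polymers (d := d) (L := L) c, polymerDiam X + 1 ≤ st X)
    {κb κs η η₁ : ℝ} (hκb : 0 ≤ κb) (hκs : κb ≤ κs)
    (hη : ∀ y : Site d L, ∑ S ∈ polymersThrough (d := d) (L := L) 1 y,
      M S * Real.exp (κs * ((st (S.image (blockCorner c)) : ℝ) - 1)) ≤ η)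
    (hη₁ : ∀ y : Site d L, ∑ S ∈ polymersThrough (d := d) (L := L) 1 y,
      M S * S.card * Real.exp (κs * ((st (S.image (blockCorner c)) : ℝ) - 1)) ≤ η₁) :
    InBall κb (2 * (Real.exp (κb * ((c : ℝ) - 1)) * η)) (2 * d / r * (Real.exp (κb * ((c : ℝ) - 1)) * η₁))
      (reindex W) :=
  inBall_of_affineDiamData w hr hosc hlip hκb hκs
    (s := fun S => (st (S.image (blockCorner c)) : ℝ) - 1) (a := (c : ℝ) - 1)
    (size_nonneg hst) (hdiam_of_supported hc hst hM) hη hη₁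

/-- (δ)-COROLLARY: `M = (reindex W).supNorm`, `t S = s (corners S)`, the diameter line = theory-1's
`polymerDiam_le_of_supNorm_reindex_ne_zero` TERM FOR TERM, the two per-site columns = the SENDER's per-corner weighted
norms via (iv-Σ) (`sum_polymersThrough_reindex_weight`, `sum_polymersThrough_reindex_card_weight_le` with the `c^d`
rider); theory-2's door `ReceiverWitness.inBall_of_natAffineDiamData`.  Hypotheses left: sender-side + an (E1) load
witness of `reindex W`. [folklore] -/
theorem inBall_reindex_of_senderData (hc : 1 ≤ c)
    (W : QuasiLocalGaugePerturbation d L (SUN N) c) (w : LoadWitness (reindex W)) {r : ℝ} (hr : 0 < r)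
    (hosc : ∀ X e, w.osc X e ≤ 2 * (reindex W).supNorm X)
    (hlip : ∀ X, ∀ y ∈ polymerEdges (d := d) (L := L) 1 X, w.lip X y = 2 * (reindex W).supNorm X / r)
    {s : Finset (Site d L) → ℕ} (hs : ∀ X ∈ polymers (d := d) (L := L) c, polymerDiam X + 1 ≤ s X)
    {κb κs η η₁ : ℝ} (hκb : 0 ≤ κb) (hκs : κb ≤ κs)
    (hη : ∀ y : Site d L, ∑ X ∈ polymersThrough c (blockCorner c y),
      W.supNorm X * Real.exp (κs * ((s X - 1 : ℕ) : ℝ)) ≤ η)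
    (hη₁ : ∀ y : Site d L, ∑ X ∈ polymersThrough c (blockCorner c y),
      W.supNorm X * X.card * Real.exp (κs * ((s X - 1 : ℕ) : ℝ)) ≤ η₁) :
    InBall κb (2 * (Real.exp (κb * ((c - 1 : ℕ) : ℝ)) * η))
      (2 * d / r * (Real.exp (κb * ((c - 1 : ℕ) : ℝ)) * ((c : ℝ) ^ d * η₁))) (reindex W) :=
  inBall_of_natAffineDiamData w hr hosc hlip hκb hκs
    (t := fun S => s (S.image (blockCorner c))) (c := c) (η₁ := (c : ℝ) ^ d * η₁)
    (fun S hS => polymerDiam_le_of_supNorm_reindex_ne_zero W hc hs hS)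
    (fun y => by rw [sum_polymersThrough_reindex_weight W s κs y]; exact hη y)
    (fun y => (sum_polymersThrough_reindex_card_weight_le W (Nat.lt_of_lt_of_le Nat.zero_lt_one hc) s κs y).trans
      (mul_le_mul_of_nonneg_left (hη₁ y) (by positivity)))

/-- ★ (St) END TO END GIVEN A LOAD WITNESS — the D3 port lemma, YES branch, in track Y2's object: with the Steiner size as
the currency (`s := steinerCard`, admissible with no hypothesis by `SteinerSize.polymerDiam_add_one_le_steinerCard`), the
re-indexed perturbation lies in `ClusterDomain κ_b (2 e^{κ_b (c−1)} η) ((2d/r) e^{κ_b (c−1)} c^d η₁)` as soon as the SENDER's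
per-corner Steiner-weighted norms are `≤ η`, `≤ η₁` and an (E1) load witness of `reindex W` is supplied. [folklore] -/
theorem mem_clusterDomain_reindex_of_steinerData (hc : 1 ≤ c)
    (W : QuasiLocalGaugePerturbation d L (SUN N) c) (w : LoadWitness (reindex W)) {r : ℝ} (hr : 0 < r)
    (hosc : ∀ X e, w.osc X e ≤ 2 * (reindex W).supNorm X)
    (hlip : ∀ X, ∀ y ∈ polymerEdges (d := d) (L := L) 1 X, w.lip X y = 2 * (reindex W).supNorm X / r)
    {κb κs η η₁ : ℝ} (hκb : 0 ≤ κb) (hκs : κb ≤ κs)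
    (hη : ∀ y : Site d L, ∑ X ∈ polymersThrough c (blockCorner c y),
      W.supNorm X * Real.exp (κs * ((steinerCard X - 1 : ℕ) : ℝ)) ≤ η)
    (hη₁ : ∀ y : Site d L, ∑ X ∈ polymersThrough c (blockCorner c y),
      W.supNorm X * X.card * Real.exp (κs * ((steinerCard X - 1 : ℕ) : ℝ)) ≤ η₁) :
    reindex W ∈ ClusterDomain κb (2 * (Real.exp (κb * ((c - 1 : ℕ) : ℝ)) * η))
      (2 * d / r * (Real.exp (κb * ((c - 1 : ℕ) : ℝ)) * ((c : ℝ) ^ d * η₁))) :=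
  inBall_reindex_of_senderData hc W w hr hosc hlip (s := steinerCard)
    (fun X _ => polymerDiam_add_one_le_steinerCard X) hκb hκs hη hη₁

/-! ## §2 ★ The YES branch END TO END from (E1) data on the sender's scale-`c` object -/

/-- ★ **(St-an) ⇒ track Y2's tier-2 ball, END TO END.**  `1 ≤ c`; `ρ` `1`-Lipschitz into `(M_N(ℂ), ‖·‖_F)`; the scale-`c`
activities analytic on domains `D X` containing the radius-`r` ball around EVERY real configuration, with bounds
`0 ≤ M X` ((E1), Bałaban's (ii) shape, `IsAnalyticOn`); rates `0 ≤ κ_b ≤ κ_s`; and the SENDER's per-CORNER analytic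
Steiner-weighted norms `∑_{X ∋ corner y} M_X e^{κ_s (st X − 1)} ≤ η`, `∑_{X ∋ corner y} M_X |X| e^{κ_s (st X − 1)} ≤ η₁`
⇒ `reindex W ∈ ClusterDomain κ_b (2 e^{κ_b (c−1)} η) ((2d/r) e^{κ_b (c−1)} c^d η₁)` (the perturbation with the SAME torus law,
`total_reindex`).  Composition: `isAnalyticOn_reindex` + theory-2's `mem_clusterDomain_of_analytic_affineDiam` + theory-1's
`size_nonneg` / `hdiam_of_supported` / (iv-Σ) + `SteinerSize.polymerDiam_add_one_le_steinerCard` + the `c^d` rider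
`card_cubeSites_le`.  No load witness, no (E2), no range control, no connectivity hypothesis remains. [folklore] -/
theorem mem_clusterDomain_reindex_of_analytic_steinerData (hc : 1 ≤ c)
    (W : QuasiLocalGaugePerturbation d L (SUN N) c) (ρ : SUN N →* Matrix (Fin N) (Fin N) ℂ)
    (hρ : ∀ a b : SUN N, dist (ρ a) (ρ b) ≤ suFrobDist a b)
    {D : Finset (Site d L) → Set (ComplexGaugeConfig d L N)} {M : Finset (Site d L) → ℝ} {r : ℝ}
    (hr : 0 < r) (hA : W.IsAnalyticOn ρ D M) (hM0 : ∀ X, 0 ≤ M X)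
    (hE1 : ∀ X (U : GaugeConfig d L (SUN N)), ball (complexify ρ U) r ⊆ D X)
    {κb κs η η₁ : ℝ} (hκb : 0 ≤ κb) (hκs : κb ≤ κs)
    (hη : ∀ y : Site d L, ∑ X ∈ polymersThrough c (blockCorner c y),
      M X * Real.exp (κs * ((steinerCard X : ℝ) - 1)) ≤ η)
    (hη₁ : ∀ y : Site d L, ∑ X ∈ polymersThrough c (blockCorner c y),
      M X * X.card * Real.exp (κs * ((steinerCard X : ℝ) - 1)) ≤ η₁) :
    reindex W ∈ ClusterDomain (d := d) (L := L) (N := N) κb (2 * (Real.exp (κb * ((c : ℝ) - 1)) * η))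
      (2 * d / r * (Real.exp (κb * ((c : ℝ) - 1)) * ((c : ℝ) ^ d * η₁))) := by
  -- the re-indexed analyticity data
  set M' : Finset (Site d L) → ℝ :=
    fun S => if cubeSites c (S.image (blockCorner c)) = S then M (S.image (blockCorner c)) else 0 with hM'def
  have hA' := isAnalyticOn_reindex W ρ hA
  have hM' : ∀ S, M' S ≠ 0 → ∃ X ∈ polymers (d := d) (L := L) c, S = cubeSites c X := by
    intro S hS
    by_cases h : cubeSites c (S.image (blockCorner c)) = S
    · exact ⟨_, image_blockCorner_mem_polymers c S, h.symm⟩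
    · exact absurd (by simp [hM'def, h]) hS
  have hM'cube : ∀ X ∈ polymers (d := d) (L := L) c, M' (cubeSites c X) = M X := by
    intro X hX
    simp [hM'def, image_blockCorner_cubeSites hX]
  have hst : ∀ X ∈ polymers (d := d) (L := L) c, polymerDiam X + 1 ≤ steinerCard X :=
    fun X _ => polymerDiam_add_one_le_steinerCard X
  have hc0 : 0 < c := Nat.lt_of_lt_of_le Nat.zero_lt_one hc
  refine mem_clusterDomain_of_analytic_affineDiam (reindex W) ρ hρ hr hA' (fun S U => hE1 _ U) hκb hκs
    (s := fun S => (steinerCard (S.image (blockCorner c)) : ℝ) - 1) (a := (c : ℝ) - 1)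
    (size_nonneg hst) (hdiam_of_supported hc hst hM') (fun y => ?_) (fun y => ?_)
  · -- first column: (iv-Σ) makes it the sender's per-corner analytic norm verbatim
    have h := sum_polymersThrough_supported_mul hM' (fun X _ => Real.exp (κs * ((steinerCard X : ℝ) - 1))) y
    refine (le_of_eq h).trans ((le_of_eq (sum_congr rfl fun X hX => ?_)).trans (hη y))
    rw [hM'cube X (mem_polymersThrough_iff.1 hX).1]
  · -- second column: (iv-Σ) + the `c^d` rider `|cubeSites c X| ≤ c^d |X|`
    have h := sum_polymersThrough_supported_mul hM'
      (fun X S => (S.card : ℝ) * Real.exp (κs * ((steinerCard X : ℝ) - 1))) y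
    have h' : ∑ S ∈ polymersThrough 1 y,
        M' S * S.card * Real.exp (κs * ((steinerCard (S.image (blockCorner c)) : ℝ) - 1))
        = ∑ X ∈ polymersThrough c (blockCorner c y),
          M X * (cubeSites c X).card * Real.exp (κs * ((steinerCard X : ℝ) - 1)) := by
      have h2 : ∑ S ∈ polymersThrough 1 y,
          M' S * S.card * Real.exp (κs * ((steinerCard (S.image (blockCorner c)) : ℝ) - 1))
          = ∑ X ∈ polymersThrough c (blockCorner c y),
            M' (cubeSites c X) * (cubeSites c X).card * Real.exp (κs * ((steinerCard X : ℝ) - 1)) := by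
        simpa only [mul_assoc] using h
      rw [h2]
      exact sum_congr rfl fun X hX => by rw [hM'cube X (mem_polymersThrough_iff.1 hX).1]
    refine (le_of_eq h').trans ?_
    calc ∑ X ∈ polymersThrough c (blockCorner c y),
          M X * (cubeSites c X).card * Real.exp (κs * ((steinerCard X : ℝ) - 1))
        ≤ ∑ X ∈ polymersThrough c (blockCorner c y),
          M X * ((c : ℝ) ^ d * X.card) * Real.exp (κs * ((steinerCard X : ℝ) - 1)) := by
            refine sum_le_sum fun X _ => ?_
            have hcard : ((cubeSites c X).card : ℝ) ≤ (c : ℝ) ^ d * X.card := by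
              exact_mod_cast card_cubeSites_le hc0 X
            exact mul_le_mul_of_nonneg_right (mul_le_mul_of_nonneg_left hcard (hM0 X)) (Real.exp_pos _).le
      _ = (c : ℝ) ^ d * ∑ X ∈ polymersThrough c (blockCorner c y),
          M X * X.card * Real.exp (κs * ((steinerCard X : ℝ) - 1)) := by
            rw [mul_sum]; exact sum_congr rfl fun X _ => by ring
      _ ≤ (c : ℝ) ^ d * η₁ := mul_le_mul_of_nonneg_left (hη₁ y) (by positivity)

end Summit.Ventures.YMGap.YM3IR.D3PortJoint

end
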